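import Mathlib
import Summits.CriticalPhenomena.SAWScalingLimit.Theorems.SAWDefectDecoherenceSectorSlavingDefs
import Summits.CriticalPhenomena.SAWScalingLimit.Theorems.SAWDefectDecoherenceDefectDecoherenceSsTipRegroupingAux1
import Summits.CriticalPhenomena.SAWScalingLimit.Theorems.SAWDefectDecoherenceDefectDecoherenceSsTipRegroupingAux2
import HarnessLib

/-!
# Star-mass Harnack, auxiliary file 2: the star mass at a tip against the mass of one of its mid-edges
(helpers for the stub `stub_starMassHarnack` of the line `sector-slaving`, crux `DefectDecoherence`,
stmt-CriticalPhenomena-8549) — the UNCONDITIONAL part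

Fix a root `a = s(u,w)` (`u ∉ Λ`), a vertex `t ∈ Λ` all of whose neighbours lie in `Λ`, `t ≠ w`, and
a neighbour `v` of `t`; write `Z(e) = Σ_{γ : a → e} x_c^{ℓ(γ)}` for the `x_c`-mass at a mid-edge,
`A_y = Σ_{clean arrivals ω at t through the dart y → t} x_c^{ℓ(ω)+1}`, and `R_y` for the mass of the
RETURN LOOPS at `(t,y)` (walks `a → s(y,t)` with last vertex `y` having visited `t`).  Splitting the
walks `a → s(y,t)` by their last vertex and the via-`t` ones by their arrival dart (`tip_sum_viaV`):
`Z(s(y,t)) = Σ_{y' ≠ y} A_{y'} + x_c⁻¹ A_y + R_y`, while `Σ_{y' ≠ v} A_{y'} + x_c⁻¹ A_v ≤ Z(s(v,t))`.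
Hence the DART HARNACK INEQUALITY at the tip `t` (`har_tip_le_add_returnLoops`):
`M(t) = Σ_{y ∼ t} Z(s(y,t)) ≤ (2 + x_c⁻¹) Z(s(v,t)) + Σ_{y ∼ t, y ≠ v} R_y` (uses `2x_c ≤ 1 + x_c⁻¹`),
and, summed over the three neighbours `t` of a `2`-deep `v` (`Σ_t Z(s(v,t)) = M(v)`), the
UNCONDITIONAL neighbour bound `har_neighbourMass_le_add_returnLoops` (registered):
`Σ_{t ∼ v} M(t) ≤ (2 + x_c⁻¹) M(v) + Σ_{t ∼ v} Σ_{s ∼ t, s ≠ v} R(t,s)`.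
The return loops — the one positive-mass input that is not a local surgery — are bounded
conditionally in `…StarMassHarnack.lean`.

Sources: H. Duminil-Copin, S. Smirnov, Ann. of Math. 175 (2012) (arXiv:1007.0575), §1–§2 (walks
between mid-edges); the line card `Lines/sector-slaving.md`.
-/

noncomputable section

open scoped BigOperators ComplexConjugate Classical
open Literature.Probability.LatticeModels Literature.Probability.RandomPlanarGeometry.SAW
open Summit.CriticalPhenomena.SAWScalingLimit.Theorems.DefectDecoherence.TipMartingale

namespace Summit.CriticalPhenomena.SAWScalingLimit.Theorems.DefectDecoherence.SectorSlaving

/-! ### Masses as sums over walks -/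

/-- At spin `0` the observable at `x = x_c` has norm `Σ_γ x_c^{ℓ(γ)}`. [folklore] -/
theorem har_norm_obs (Λ : Finset HexVertex) (a e : Sym2 HexVertex) :
    ‖hexParafermionicObservable Λ a xc 0 e‖ = ∑ γ : HexMidEdgeSAW Λ a e, xc ^ γ.length := by
  rw [hexParafermionicObservable_zero_spin, Complex.norm_real,
    Real.norm_of_nonneg (Finset.sum_nonneg fun γ _ => pow_nonneg xc_pos.le _)]

/-- The star mass at `t`, written over the darts INTO `t`: `M(t) = Σ_{s ∼ t} Z(s(s,t))`. [folklore] -/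
theorem har_mass_eq_sum_in (Λ : Finset HexVertex) (u w t : HexVertex) :
    mass Λ u w t = ∑ s ∈ star Λ t, ∑ γ : HexMidEdgeSAW Λ s(u, w) s(s, t), xc ^ γ.length := by
  unfold mass
  refine Finset.sum_congr rfl fun s _ => ?_
  rw [har_norm_obs, Sym2.eq_swap (a := t) (b := s)]

/-- A sum over a three-element set. [folklore] -/
theorem har_sum_three {M : Type*} [AddCommMonoid M] {v s₁ s₂ : HexVertex} (h₁ : v ≠ s₁)
    (h₂ : v ≠ s₂) (h₃ : s₁ ≠ s₂) (f : HexVertex → M) :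
    ∑ y ∈ ({v, s₁, s₂} : Finset HexVertex), f y = f v + f s₁ + f s₂ := by
  rw [Finset.sum_insert (by simp [h₁, h₂]), Finset.sum_pair h₃, add_assoc]

/-! ### The walks at a dart of the tip `t` -/

section Tip

variable {Λ : Finset HexVertex} {u w v t y : HexVertex}

/-- **Via-`t` walks at the dart `y → t`** are the clean arrivals at `t` through the OTHER darts,
prolonged by `t` (one factor `x_c`). [folklore] -/
theorem har_viaT_eq (hu : u ∉ Λ) (ht : t ∈ Λ) (hwt : w ≠ t) (hy : y ∈ star Λ t) :
    ∑ γ : HexMidEdgeSAW Λ s(u, w) s(y, t),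
        (if γ.verts.getLast? = some t then xc ^ γ.length else 0) =
      ∑ y' ∈ star Λ t, (if y' = y then 0 else ∑ ω : HexMidEdgeSAW Λ s(u, w) s(y', t),
        if ω.verts.getLast? = some y' ∧ t ∉ ω.verts then xc ^ (ω.length + 1) else 0) := by
  have h := tip_sum_viaV hu ht hwt hy (fun l : List HexVertex => (xc : ℝ) ^ l.length)
  simp only [List.length_append, List.length_singleton] at h
  simp only [HexMidEdgeSAW.length]
  rw [h]
  refine Finset.sum_congr rfl fun y' _ => ?_
  by_cases hy' : y' = y
  · simp [hy']
  · simp [hy']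

/-- **Via-`y` walks at the dart `y → t`** (last vertex `y`) split into the clean arrivals at `t`
(`t ∉ γ`; their mass is `x_c⁻¹ A_y`) and the return loops (`t ∈ γ`). [folklore] -/
theorem har_viaY_eq (y : HexVertex) :
    ∑ γ : HexMidEdgeSAW Λ s(u, w) s(y, t),
        (if γ.verts.getLast? = some y then xc ^ γ.length else 0) =
      xc⁻¹ * (∑ ω : HexMidEdgeSAW Λ s(u, w) s(y, t),
          if ω.verts.getLast? = some y ∧ t ∉ ω.verts then xc ^ (ω.length + 1) else 0) +
        ∑ γ : HexMidEdgeSAW Λ s(u, w) s(y, t),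
          (if γ.verts.getLast? = some y ∧ t ∈ γ.verts then xc ^ γ.length else 0) := by
  rw [Finset.mul_sum, ← Finset.sum_add_distrib]
  refine Finset.sum_congr rfl fun γ _ => ?_
  by_cases h1 : γ.verts.getLast? = some y
  · by_cases h2 : t ∈ γ.verts
    · rw [if_pos h1, if_neg (fun h => h.2 h2), if_pos ⟨h1, h2⟩, mul_zero, zero_add]
    · rw [if_pos h1, if_pos ⟨h1, h2⟩, if_neg (fun h => h2 h.2), add_zero, pow_succ,
        mul_comm (xc ^ _) xc, ← mul_assoc, inv_mul_cancel₀ xc_pos.ne', one_mul]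
  · rw [if_neg h1, if_neg (fun h => h1 h.1), if_neg (fun h => h1 h.1), mul_zero, zero_add]

/-- The clean arrivals at `t` through the dart `v → t` are among the via-`v` walks at `s(v,t)`:
`A_v ≤ x_c · (via-`v` mass)`. [folklore] -/
theorem har_clean_le_viaY (y : HexVertex) :
    (∑ ω : HexMidEdgeSAW Λ s(u, w) s(y, t),
        if ω.verts.getLast? = some y ∧ t ∉ ω.verts then xc ^ (ω.length + 1) else 0) ≤
      xc * ∑ γ : HexMidEdgeSAW Λ s(u, w) s(y, t),
        (if γ.verts.getLast? = some y then xc ^ γ.length else 0) := by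
  rw [Finset.mul_sum]
  refine Finset.sum_le_sum fun γ _ => ?_
  by_cases h1 : γ.verts.getLast? = some y ∧ t ∉ γ.verts
  · rw [if_pos h1, if_pos h1.1, pow_succ, mul_comm]
  · rw [if_neg h1]
    split_ifs
    · exact mul_nonneg xc_pos.le (pow_nonneg xc_pos.le _)
    · rw [mul_zero]

end Tip

/-! ### The dart Harnack inequality at a tip -/

section Harnack

variable {Λ : Finset HexVertex} {u w v t : HexVertex}

/-- `2 x_c ≤ 1 + x_c⁻¹` (indeed `x_c < 1`). [folklore] -/
theorem har_two_xc_le : 2 * xc ≤ 1 + xc⁻¹ := by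
  have h0 : 0 < xc := xc_pos
  have h1 : xc < 1 := hexCriticalFugacity_pos_lt_one.2
  have h2 : 1 ≤ xc⁻¹ := one_le_inv_iff₀.2 ⟨h0, h1.le⟩
  linarith

/-- **Dart Harnack inequality at a tip, with the return loops explicit.**  For `u ∉ Λ ∋ t`,
`t ≠ w`, all neighbours of `t` in `Λ` and `v ∼ t`:
`M(t) ≤ (2 + x_c⁻¹) Z(s(v,t)) + Σ_{s ∼ t, s ≠ v} R_s` (return loops at `(t,s)`). [folklore] -/
theorem har_tip_le_add_returnLoops (hu : u ∉ Λ) (ht : t ∈ Λ) (hwt : w ≠ t)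
    (htv : hexGraph.Adj t v) (hΛt : ∀ y, hexGraph.Adj t y → y ∈ Λ) :
    ∑ s ∈ star Λ t, ∑ γ : HexMidEdgeSAW Λ s(u, w) s(s, t), xc ^ γ.length ≤
      (2 + xc⁻¹) * (∑ γ : HexMidEdgeSAW Λ s(u, w) s(v, t), xc ^ γ.length) +
        ∑ s ∈ star Λ t, (if s = v then 0 else ∑ γ : HexMidEdgeSAW Λ s(u, w) s(s, t),
          (if γ.verts.getLast? = some s ∧ t ∈ γ.verts then xc ^ γ.length else 0)) := by
  -- the three darts at `t`
  obtain ⟨n₁, n₂, n₃⟩ := tip_rot3_ne htv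
  have hstar := tip_star_eq htv hΛt
  set s₁ := rot3 t v with hs₁
  set s₂ := rot3 t (rot3 t v) with hs₂
  have hv : v ∈ star Λ t := by rw [hstar]; simp
  have h1 : s₁ ∈ star Λ t := by rw [hstar]; simp
  have h2 : s₂ ∈ star Λ t := by rw [hstar]; simp
  -- the quantities
  set A : HexVertex → ℝ := fun y => ∑ ω : HexMidEdgeSAW Λ s(u, w) s(y, t),
    if ω.verts.getLast? = some y ∧ t ∉ ω.verts then xc ^ (ω.length + 1) else 0 with hA
  set R : HexVertex → ℝ := fun y => ∑ γ : HexMidEdgeSAW Λ s(u, w) s(y, t),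
    (if γ.verts.getLast? = some y ∧ t ∈ γ.verts then xc ^ γ.length else 0) with hR
  set V : HexVertex → ℝ := fun y => ∑ γ : HexMidEdgeSAW Λ s(u, w) s(y, t),
    (if γ.verts.getLast? = some t then xc ^ γ.length else 0) with hV
  set V' : HexVertex → ℝ := fun y => ∑ γ : HexMidEdgeSAW Λ s(u, w) s(y, t),
    (if γ.verts.getLast? = some y then xc ^ γ.length else 0) with hV'
  set Z : HexVertex → ℝ := fun y => ∑ γ : HexMidEdgeSAW Λ s(u, w) s(y, t), xc ^ γ.length with hZ
  have hA0 : ∀ y, 0 ≤ A y := fun y => Finset.sum_nonneg fun ω _ => by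
    split_ifs
    · exact pow_nonneg xc_pos.le _
    · exact le_rfl
  have hV0 : ∀ y, 0 ≤ V y := fun y => Finset.sum_nonneg fun ω _ => by
    split_ifs
    · exact pow_nonneg xc_pos.le _
    · exact le_rfl
  have hV'0 : ∀ y, 0 ≤ V' y := fun y => Finset.sum_nonneg fun ω _ => by
    split_ifs
    · exact pow_nonneg xc_pos.le _
    · exact le_rfl
  -- last-vertex split at each dart
  have hsplit : ∀ y ∈ star Λ t, Z y = V' y + V y := fun y hy => by
    obtain ⟨hyΛ, hty⟩ := tip_mem_star.1 hy
    exact tip_sum_split_last hu ht hyΛ hty.ne.symm _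
  -- via-`y` walks: clean arrivals and return loops
  have hviaY : ∀ y, V' y = xc⁻¹ * A y + R y := fun y => har_viaY_eq y
  -- via-`t` walks: clean arrivals through the other darts
  have hviaT : ∀ y ∈ star Λ t, V y = ∑ y' ∈ star Λ t, (if y' = y then 0 else A y') :=
    fun y hy => har_viaT_eq hu ht hwt hy
  have hVv : V v = A s₁ + A s₂ := by
    rw [hviaT v hv, hstar, har_sum_three n₁ n₂ n₃]; simp [n₁.symm, n₂.symm]
  have hV1 : V s₁ = A v + A s₂ := by
    rw [hviaT s₁ h1, hstar, har_sum_three n₁ n₂ n₃]; simp [n₁, n₃.symm]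
  have hV2 : V s₂ = A v + A s₁ := by
    rw [hviaT s₂ h2, hstar, har_sum_three n₁ n₂ n₃]; simp [n₂, n₃]
  have hAv : A v ≤ xc * V' v := har_clean_le_viaY v
  -- assemble
  have hxc := har_two_xc_le
  have hx0 : 0 < xc := xc_pos
  have key : Z s₁ + Z s₂ ≤ (1 + xc⁻¹) * Z v + (R s₁ + R s₂) := by
    rw [hsplit s₁ h1, hsplit s₂ h2, hsplit v hv, hviaY s₁, hviaY s₂, hV1, hV2, hVv]
    have e1 : 2 * A v ≤ (1 + xc⁻¹) * V' v := by
      calc 2 * A v ≤ 2 * (xc * V' v) := by linarith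
        _ = (2 * xc) * V' v := by ring
        _ ≤ (1 + xc⁻¹) * V' v := mul_le_mul_of_nonneg_right hxc (hV'0 v)
    have e2 : 0 ≤ xc⁻¹ := inv_nonneg.2 hx0.le
    nlinarith [hA0 s₁, hA0 s₂, e2]
  calc ∑ s ∈ star Λ t, Z s = Z v + Z s₁ + Z s₂ := by rw [hstar, har_sum_three n₁ n₂ n₃]
    _ ≤ Z v + ((1 + xc⁻¹) * Z v + (R s₁ + R s₂)) := by linarith
    _ = (2 + xc⁻¹) * Z v + (R s₁ + R s₂) := by ring
    _ = (2 + xc⁻¹) * Z v + ∑ s ∈ star Λ t, (if s = v then 0 else R s) := by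
      rw [hstar, har_sum_three n₁ n₂ n₃]; simp [n₁.symm, n₂.symm]

end Harnack

/-! ### Geometry of a `2`-deep vertex -/

section Deep

variable {Λ : Finset HexVertex} {u w v t : HexVertex}

/-- At a `2`-deep vertex `v`, the neighbours of a neighbour `t` lie in `Λ`. [folklore] -/
theorem har_nbrs_mem (hdeep : Deep Λ v 2) (hvt : hexGraph.Adj v t) :
    ∀ y, hexGraph.Adj t y → y ∈ Λ := fun y hty => hdeep y (by
  linarith [dist_triangle (hexCenter y) (hexCenter t) (hexCenter v),
    dist_hexCenter_le_one_of_adj hty.symm, dist_hexCenter_le_one_of_adj hvt.symm])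

/-- At a `2`-deep vertex `v` (root `s(u,w)`, `u ∉ Λ`, `u ∼ w`), the root vertex `w` is not a
neighbour of `v` (else `u` would be `2`-close to `v`). [folklore] -/
theorem har_root_ne (hdeep : Deep Λ v 2) (huw : hexGraph.Adj u w) (hu : u ∉ Λ)
    (hvt : hexGraph.Adj v t) : w ≠ t := by
  intro h
  subst h
  refine hu (hdeep u ?_)
  linarith [dist_triangle (hexCenter u) (hexCenter w) (hexCenter v),
    dist_hexCenter_le_one_of_adj huw, dist_hexCenter_le_one_of_adj hvt.symm]

end Deep

/-! ### Summing over the star of `v` -/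

/-- **Neighbour star masses against `M(v)`, with the return loops explicit (UNCONDITIONAL).**
For an adjacent boundary root `s(u,w)` (`u ∉ Λ ∋ w`) and a `2`-deep `v`:
`Σ_{t ∼ v} M(t) ≤ (2 + x_c⁻¹) M(v) + Σ_{t ∼ v} Σ_{s ∼ t, s ≠ v} R(t,s)`, `R(t,s)` the `x_c`-mass of
the walks `s(u,w) → s(s,t)` with last vertex `s` that have visited `t`. [folklore] -/
theorem har_neighbourMass_le_add_returnLoops :
    ∀ (Λ : Finset HexVertex) (u w : HexVertex), hexGraph.Adj u w → u ∉ Λ → w ∈ Λ → ∀ v :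
    HexVertex, Deep Λ v 2 → ∑ t ∈ star Λ v, mass Λ u w t ≤ (2 + xc⁻¹) * mass Λ u w v + ∑ t ∈
    star Λ v, ∑ s ∈ star Λ t, (if s = v then 0 else ∑ γ : HexMidEdgeSAW Λ s(u, w) s(s, t), (if
    γ.verts.getLast? = some s ∧ t ∈ γ.verts then xc ^ γ.length else 0)) := by
  intro Λ u w huw hu _ v hdeep
  have hM : mass Λ u w v = ∑ t ∈ star Λ v, ∑ γ : HexMidEdgeSAW Λ s(u, w) s(v, t), xc ^ γ.length :=
    Finset.sum_congr rfl fun t _ => har_norm_obs _ _ _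
  rw [hM, Finset.mul_sum, ← Finset.sum_add_distrib]
  refine Finset.sum_le_sum fun t ht => ?_
  obtain ⟨htΛ, hvt⟩ := tip_mem_star.1 ht
  rw [har_mass_eq_sum_in]
  exact har_tip_le_add_returnLoops hu htΛ (har_root_ne hdeep huw hu hvt) hvt.symm
    (har_nbrs_mem hdeep hvt)

end Summit.CriticalPhenomena.SAWScalingLimit.Theorems.DefectDecoherence.SectorSlaving

end
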